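import Literature.NumberTheory.Irrationality.Zlobin2005.SorokinIntegralCoefficients
import Literature.InformationTheory.Entropy.MultinomialBound
import HarnessLib

/-!
# Growth of the coefficients of the linear forms from Sorokin-type integrals (Zlobin 2005, §4)

Topic `Literature/NumberTheory/Irrationality/Zlobin2005`. Companion of `SorokinIntegralCoefficients.lean`
(§§1–3: the expansion `S(z) = Σ_{s⃗} P_{s⃗}(z⁻¹) Le_{s⃗}(z)` and its DENOMINATORS); this file types §4 of
S. A. Zlobin, *Properties of coefficients of certain linear forms in generalized polylogarithms*, Fundam. Prikl.
Mat. **11** (2005), no. 6, 41–58 = arXiv:math/0511245 [Zlobin2005Coefficients] — the HEIGHTS (sizes) of the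
polynomials `P_{s⃗}` when the parameters grow linearly — with Lemma 5 PROVED and Theorem 2 a named fact
(D-0014). PRIMARY SOURCE read on the page (held `paper:arxiv-math_0511245`, arXiv text pp. 7–10). Cell
zeta5-irr (HONEST FRAMING: systematic search; no irrationality claim unless certified): the growth side of
the criterion for Sorokin-type candidates (zi-p1), next to the denominator side (`theorem1`).

§4 [cite: Zlobin2005Coefficients, §4 Lemma 5]: "**Lemma 5.** For nonnegative integers `a` and `b`, the following
estimate holds: `1/(a+b+1) · (a+b)^{a+b}/(a^a b^b) ≤ (a+b)!/(a! b!) ≤ (a+b)^{a+b}/(a^a b^b)` (if `x = 0`, we let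
`x^x = 1`)."

[cite: Zlobin2005Coefficients, §4 (before Lemma 6)]: "suppose that the parameters `a_i, b_i, c_j` depend linearly
on an increasing parameter `n`, i.e. `a_i = α_i n + α_i'`, `b_i = β_i n + β_i'`, `c_j = γ_j n + γ_j'`,
`α_i, β_i, γ_j ∈ ℕ`, `α_i', β_i', γ_j' ∈ ℤ`. As before, `q_j = Σ_{i=r_{j−1}+1}^{r_j} (b_i − a_i)`. We also use
notation `p_j = min_{r_{j−1}+1 ≤ i ≤ r_j} a_i − 1`, `P_j = max_{r_{j−1}+1 ≤ i ≤ r_j} b_i − 2`,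
`h_j = min_{r_{j−1}+1 ≤ i ≤ r_j} α_i`, `H_j = max_{r_{j−1}+1 ≤ i ≤ r_j} β_i`, `φ(x,y) = |x+y|^{x+y}·|x|^{−x}`.
Here and in what follows, `|x|^x = 1` if `x = 0`". Lemma 6 defines
`F(x₁,…,x_l) = ∏_{j=1}^l ∏_{i=r_{j−1}+1}^{r_j} (β_i−α_i)^{β_i−α_i}/φ(α_i − h_j − (H_j−h_j)x_j, β_i−α_i)
  × ∏_{j=1}^{l−1} φ(h_{j+1} + (H_{j+1}−h_{j+1})x_{j+1} − h_j − (H_j−h_j)x_j, γ_j)/γ_j^{γ_j}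
  × φ(h_l + (H_l−h_l)x_l − γ_l, γ_l)/γ_l^{γ_l}` (4).
[cite: Zlobin2005Coefficients, §4 Theorem 2]: "**Theorem 2.** Let `c₁ ≤ q₁` and `c_{j−1} + c_j ≤ q_j` for
`j = 2,…,l`. Then the heights of all polynomials in the linear form `S(z) = Σ_{s⃗} P_{s⃗}(z⁻¹) Le_{s⃗}(z)` do not
exceed `M^{n+o(n)}`, as `n → ∞`, where `M` is the maximum of function (4) on the cube `[0,1]^l`."

RENDERING (tree vocabulary; the §§1–3 file supplies `Params`, `Params.S`, `Params.q`, `IsLeExpansion`).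
* Lemma 5 is PROVED over `ℕ` in the cleared form `(a+b)^{a+b} ≤ (a+b+1)·C(a+b,a)·a^a·b^b` and
  `C(a+b,a)·a^a·b^b ≤ (a+b)^{a+b}` (`0^0 = 1` in Lean, as in the source) — by the binomial theorem and the
  unimodality of its terms (the source integrates `x^a(1−x)^b` instead); the upper half is the tree's
  `InformationTheory.Entropy.choose_mul_pow_mul_pow_le` (reused, not re-proved).
* Linear parameter families are `LinParams` (block structure `l, m, r` and `α, α', β, β', γ, γ'`), with
  `paramsAt n` the `Params` of §1 at `a_i = α_i n + α_i'`, … (integers, truncated by `Int.toNat`; the hypotheses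
  `Hyp` make them `≥ 1` for every `n ≥ 1`, with `b_i > a_i`, `c_j ≥ 1`, and the two printed inequalities
  `c₁ ≤ q₁`, `c_{j−1} + c_j ≤ q_j` for every `n ≥ 1`; `α_i, β_i, γ_j ≥ 1` as `ℕ` in the source means positive).
* `phiZ x y = |x+y|^{x+y}·|x|^{−x}` with `Real.rpow` (`0^0 = 1`); `growthF` is (4) with `h_j = blockMin α`,
  `H_j = blockMax β`; "`M` = max of `F` on `[0,1]^l`" is typed in the (equivalent, for an upper bound) form
  "every `M` with `F ≤ M` on the cube"; "heights `≤ M^{n+o(n)}`" is `∀ ε > 0`, eventually in `n`, every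
  coefficient of every polynomial of the (existing, positive-index) expansion is `≤ exp(n (log M + ε))` in
  absolute value — existence form as in `theorem1` ("the" polynomials by `expansion_unique`).
NOT here: Lemma 6 (the coefficient bound `|A_{s⃗,k⃗}| ≤ F(x)^{n+o(n)}` of the multivariable partial fractions,
internal to the proof), the Remark after Lemma 5.
-/

noncomputable section

open Finset Filter Polynomial

namespace Literature.NumberTheory.Irrationality.Zlobin2005

/-! ### Lemma 5: two-sided bounds for binomial coefficients (PROVED) -/

/-- One step up of the binomial terms `t_k = C(n,k) a^k b^{n−k}` (`n = a+b`) below the mode: for `k + 1 ≤ a`,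
`t_k ≤ t_{k+1}`. [cite: Zlobin2005Coefficients, §4 Lemma 5 (proof)] -/
theorem binomTerm_le_succ {a b k : ℕ} (hk : k + 1 ≤ a) :
    (a + b).choose k * a ^ k * b ^ (a + b - k) ≤ (a + b).choose (k + 1) * a ^ (k + 1) * b ^ (a + b - (k + 1)) := by
  have hsucc := Nat.choose_succ_right_eq (a + b) k
  -- `C(n,k+1) (k+1) = C(n,k) (n-k)`
  have hkey : (a + b).choose k * b * (k + 1) ≤ (a + b).choose (k + 1) * a * (k + 1) := by
    have h1 : b * (k + 1) ≤ (a + b - k) * a := by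
      have : b + 1 ≤ a + b - k := by omega
      calc b * (k + 1) ≤ b * a := Nat.mul_le_mul_left _ hk
        _ ≤ (b + 1) * a := Nat.mul_le_mul_right _ (Nat.le_succ b)
        _ ≤ (a + b - k) * a := Nat.mul_le_mul_right _ this
    calc (a + b).choose k * b * (k + 1) = (a + b).choose k * (b * (k + 1)) := by ring
      _ ≤ (a + b).choose k * ((a + b - k) * a) := Nat.mul_le_mul_left _ h1
      _ = ((a + b).choose k * (a + b - k)) * a := by ring
      _ = ((a + b).choose (k + 1) * (k + 1)) * a := by rw [hsucc]
      _ = (a + b).choose (k + 1) * a * (k + 1) := by ring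
  have hkey' : (a + b).choose k * b ≤ (a + b).choose (k + 1) * a :=
    Nat.le_of_mul_le_mul_right hkey (Nat.succ_pos k)
  have hexp : a + b - k = (a + b - (k + 1)) + 1 := by omega
  calc (a + b).choose k * a ^ k * b ^ (a + b - k)
      = ((a + b).choose k * b) * (a ^ k * b ^ (a + b - (k + 1))) := by rw [hexp, pow_succ]; ring
    _ ≤ ((a + b).choose (k + 1) * a) * (a ^ k * b ^ (a + b - (k + 1))) := Nat.mul_le_mul_right _ hkey'
    _ = (a + b).choose (k + 1) * a ^ (k + 1) * b ^ (a + b - (k + 1)) := by rw [pow_succ]; ring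

/-- One step down of the binomial terms above the mode: for `a ≤ k`, `t_{k+1} ≤ t_k`.
[cite: Zlobin2005Coefficients, §4 Lemma 5 (proof)] -/
theorem binomTerm_succ_le {a b k : ℕ} (hk : a ≤ k) (hkn : k + 1 ≤ a + b) :
    (a + b).choose (k + 1) * a ^ (k + 1) * b ^ (a + b - (k + 1)) ≤ (a + b).choose k * a ^ k * b ^ (a + b - k) := by
  have hsucc := Nat.choose_succ_right_eq (a + b) k
  have hkey : (a + b).choose (k + 1) * a * (k + 1) ≤ (a + b).choose k * b * (k + 1) := by
    have h1 : (a + b - k) * a ≤ b * (k + 1) := by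
      have : a + b - k ≤ b := by omega
      calc (a + b - k) * a ≤ b * a := Nat.mul_le_mul_right _ this
        _ ≤ b * (k + 1) := Nat.mul_le_mul_left _ (by omega)
    calc (a + b).choose (k + 1) * a * (k + 1) = ((a + b).choose (k + 1) * (k + 1)) * a := by ring
      _ = ((a + b).choose k * (a + b - k)) * a := by rw [hsucc]
      _ = (a + b).choose k * ((a + b - k) * a) := by ring
      _ ≤ (a + b).choose k * (b * (k + 1)) := Nat.mul_le_mul_left _ h1
      _ = (a + b).choose k * b * (k + 1) := by ring
  have hkey' : (a + b).choose (k + 1) * a ≤ (a + b).choose k * b :=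
    Nat.le_of_mul_le_mul_right hkey (Nat.succ_pos k)
  have hexp : a + b - k = (a + b - (k + 1)) + 1 := by omega
  calc (a + b).choose (k + 1) * a ^ (k + 1) * b ^ (a + b - (k + 1))
      = ((a + b).choose (k + 1) * a) * (a ^ k * b ^ (a + b - (k + 1))) := by rw [pow_succ]; ring
    _ ≤ ((a + b).choose k * b) * (a ^ k * b ^ (a + b - (k + 1))) := Nat.mul_le_mul_right _ hkey'
    _ = (a + b).choose k * a ^ k * b ^ (a + b - k) := by rw [hexp, pow_succ]; ring

/-- The term at the mode dominates: `C(a+b,k) a^k b^{a+b−k} ≤ C(a+b,a) a^a b^{(a+b)−a}` for `k ≤ a+b`.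
[cite: Zlobin2005Coefficients, §4 Lemma 5 (proof)] -/
theorem binomTerm_le_mode (a b k : ℕ) (hkn : k ≤ a + b) :
    (a + b).choose k * a ^ k * b ^ (a + b - k) ≤ (a + b).choose a * a ^ a * b ^ (a + b - a) := by
  by_cases hka : k ≤ a
  · -- climb from `k` to `a`
    have step : ∀ e, k + e ≤ a →
        (a + b).choose k * a ^ k * b ^ (a + b - k) ≤
          (a + b).choose (k + e) * a ^ (k + e) * b ^ (a + b - (k + e)) := by
      intro e he
      induction e with
      | zero => simp
      | succ e ihe =>
        have h1 := ihe (by omega)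
        have h2 := @binomTerm_le_succ a b (k + e) (by omega)
        have hx : k + e + 1 = k + (e + 1) := by ring
        rw [hx] at h2
        exact h1.trans h2
    have h := step (a - k) (by omega)
    have hx : k + (a - k) = a := by omega
    rw [hx] at h
    exact h
  · -- descend from `a` to `k`
    have step : ∀ e, a + e ≤ a + b →
        (a + b).choose (a + e) * a ^ (a + e) * b ^ (a + b - (a + e)) ≤
          (a + b).choose a * a ^ a * b ^ (a + b - a) := by
      intro e he
      induction e with
      | zero => simp
      | succ e ihe =>
        have h1 := ihe (by omega)
        have h2 := @binomTerm_succ_le a b (a + e) (by omega) (by omega)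
        have hx : a + e + 1 = a + (e + 1) := by ring
        rw [hx] at h2
        exact h2.trans h1
    have h := step (k - a) (by omega)
    have hx : a + (k - a) = k := by omega
    rw [hx] at h
    exact h

/-- **Zlobin 2005, Lemma 5, lower bound** (PROVED): `(a+b)^{a+b} ≤ (a+b+1)·C(a+b,a)·a^a·b^b` (the `a+b+1`
terms of the binomial expansion are each at most the term at the mode). [cite: Zlobin2005Coefficients, §4 Lemma 5] -/
theorem lemma5_lower (a b : ℕ) : (a + b) ^ (a + b) ≤ (a + b + 1) * ((a + b).choose a * a ^ a * b ^ b) := by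
  have hexp : (a + b) ^ (a + b) = ∑ k ∈ Finset.range (a + b + 1), a ^ k * b ^ (a + b - k) * (a + b).choose k :=
    add_pow a b (a + b)
  rw [hexp]
  calc ∑ k ∈ Finset.range (a + b + 1), a ^ k * b ^ (a + b - k) * (a + b).choose k
      ≤ ∑ _k ∈ Finset.range (a + b + 1), (a + b).choose a * a ^ a * b ^ b := by
        apply Finset.sum_le_sum
        intro k hk
        have hk' : k ≤ a + b := by rw [Finset.mem_range] at hk; omega
        have hm := binomTerm_le_mode a b k hk'
        rw [Nat.add_sub_cancel_left] at hm
        calc a ^ k * b ^ (a + b - k) * (a + b).choose k = (a + b).choose k * a ^ k * b ^ (a + b - k) := by ring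
          _ ≤ (a + b).choose a * a ^ a * b ^ b := hm
    _ = (a + b + 1) * ((a + b).choose a * a ^ a * b ^ b) := by
        rw [Finset.sum_const, Finset.card_range, smul_eq_mul]

/-- **Zlobin 2005, Lemma 5** in the printed two-sided real form:
`(a+b)^{a+b}/(a^a b^b (a+b+1)) ≤ (a+b)!/(a!b!) ≤ (a+b)^{a+b}/(a^a b^b)` (with `0^0 = 1`).
[cite: Zlobin2005Coefficients, §4 Lemma 5] -/
theorem lemma5 (a b : ℕ) :
    ((a + b : ℕ) : ℝ) ^ (a + b) / ((a : ℝ) ^ a * (b : ℝ) ^ b * ((a + b : ℕ) + 1)) ≤ ((a + b).choose a : ℝ) ∧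
      ((a + b).choose a : ℝ) ≤ ((a + b : ℕ) : ℝ) ^ (a + b) / ((a : ℝ) ^ a * (b : ℝ) ^ b) := by
  have hpos : (0 : ℝ) < (a : ℝ) ^ a * (b : ℝ) ^ b := by
    apply mul_pos
    · rcases Nat.eq_zero_or_pos a with h | h
      · subst h; simp
      · positivity
    · rcases Nat.eq_zero_or_pos b with h | h
      · subst h; simp
      · positivity
  have hup := Literature.InformationTheory.Entropy.choose_mul_pow_mul_pow_le a b
  have hlo := lemma5_lower a b
  constructor
  · rw [div_le_iff₀ (by positivity)]
    have : ((a + b : ℕ) : ℝ) ^ (a + b) ≤ ((a + b + 1 : ℕ) : ℝ) * (((a + b).choose a : ℕ) * (a : ℝ) ^ a * (b : ℝ) ^ b) := by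
      exact_mod_cast hlo
    push_cast at this ⊢
    linarith
  · rw [le_div_iff₀ hpos, ← mul_assoc]
    exact_mod_cast hup

/-! ### Linearly growing parameters and Theorem 2 -/

/-- A family of parameter sets depending linearly on `n`: fixed block structure `(l, m, r)` and
`a_i = α_i n + α_i'`, `b_i = β_i n + β_i'`, `c_j = γ_j n + γ_j'` (`α_i, β_i, γ_j` positive integers,
`α_i', β_i', γ_j' ∈ ℤ`). [cite: Zlobin2005Coefficients, §4 (before Lemma 6)] -/
structure LinParams where
  /-- number of denominator factors `l` -/
  l : ℕ
  /-- dimension `m` -/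
  m : ℕ
  /-- block ends `r₀,…,r_l` -/
  r : ℕ → ℕ
  /-- `α_i` -/
  α : ℕ → ℕ
  /-- `α_i'` -/
  α' : ℕ → ℤ
  /-- `β_i` -/
  β : ℕ → ℕ
  /-- `β_i'` -/
  β' : ℕ → ℤ
  /-- `γ_j` -/
  γ : ℕ → ℕ
  /-- `γ_j'` -/
  γ' : ℕ → ℤ

namespace LinParams

/-- `a_i(n) = α_i n + α_i'` as an integer. [cite: Zlobin2005Coefficients, §4 (before Lemma 6)] -/
def aZ (L : LinParams) (n i : ℕ) : ℤ := (L.α i : ℤ) * n + L.α' i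

/-- `b_i(n) = β_i n + β_i'` as an integer. [cite: Zlobin2005Coefficients, §4 (before Lemma 6)] -/
def bZ (L : LinParams) (n i : ℕ) : ℤ := (L.β i : ℤ) * n + L.β' i

/-- `c_j(n) = γ_j n + γ_j'` as an integer. [cite: Zlobin2005Coefficients, §4 (before Lemma 6)] -/
def cZ (L : LinParams) (n j : ℕ) : ℤ := (L.γ j : ℤ) * n + L.γ' j

/-- The parameter set of §1 at the `n`-th member of the family (integers truncated by `Int.toNat`; under `Hyp`
they are `≥ 1`). [cite: Zlobin2005Coefficients, §4 (before Lemma 6)] -/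
def paramsAt (L : LinParams) (n : ℕ) : Params where
  l := L.l
  m := L.m
  r := L.r
  a := fun i => (L.aZ n i).toNat
  b := fun i => (L.bZ n i).toNat
  c := fun j => (L.cZ n j).toNat

/-- The hypotheses under which Theorem 2 is typed: the block structure of §1; `α_i, β_i, γ_j ≥ 1`; for every
`n ≥ 1` the §1 standing conditions `b_i > a_i ≥ 1`, `c_j ≥ 1`, and the printed `c₁ ≤ q₁`, `c_{j−1} + c_j ≤ q_j`
(`j = 2,…,l`). [cite: Zlobin2005Coefficients, §4 Theorem 2 (hypotheses) and §1] -/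
structure Hyp (L : LinParams) : Prop where
  shape : ∀ n, (L.paramsAt n).Shape
  pos : (∀ i ∈ Finset.Icc 1 L.m, 1 ≤ L.α i ∧ 1 ≤ L.β i) ∧ ∀ j ∈ Finset.Icc 1 L.l, 1 ≤ L.γ j
  params : ∀ n, 1 ≤ n → (∀ i ∈ Finset.Icc 1 L.m, 1 ≤ L.aZ n i ∧ L.aZ n i < L.bZ n i) ∧
    ∀ j ∈ Finset.Icc 1 L.l, 1 ≤ L.cZ n j
  c_one : ∀ n, 1 ≤ n → (L.paramsAt n).c 1 ≤ (L.paramsAt n).q 1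
  c_succ : ∀ n, 1 ≤ n → ∀ j ∈ Finset.Icc 2 L.l, (L.paramsAt n).c (j - 1) + (L.paramsAt n).c j ≤ (L.paramsAt n).q j

/-- `h_j = min_{r_{j−1} < i ≤ r_j} α_i` (`0` on an empty block). [cite: Zlobin2005Coefficients, §4 (before Lemma 6)] -/
def hMin (L : LinParams) (j : ℕ) : ℕ :=
  if hne : (Finset.Ioc (L.r (j - 1)) (L.r j)).Nonempty then (Finset.Ioc (L.r (j - 1)) (L.r j)).inf' hne L.α else 0

/-- `H_j = max_{r_{j−1} < i ≤ r_j} β_i`. [cite: Zlobin2005Coefficients, §4 (before Lemma 6)] -/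
def hMax (L : LinParams) (j : ℕ) : ℕ := (Finset.Ioc (L.r (j - 1)) (L.r j)).sup L.β

end LinParams

/-- `φ(x,y) = |x+y|^{x+y}·|x|^{−x}` (real powers, `0⁰ = 1`). [cite: Zlobin2005Coefficients, §4 (before Lemma 6)] -/
def phiZ (x y : ℝ) : ℝ := |x + y| ^ (x + y) * (|x| ^ x)⁻¹

/-- Zlobin's function (4) of Lemma 6 / Theorem 2 on the cube `[0,1]^l` (`x` read at `1,…,l`):
`F(x) = ∏_j ∏_{i ∈ block j} (β_i−α_i)^{β_i−α_i}/φ(α_i − h_j − (H_j−h_j)x_j, β_i−α_i)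
 · ∏_{j<l} φ(h_{j+1} + (H_{j+1}−h_{j+1})x_{j+1} − h_j − (H_j−h_j)x_j, γ_j)/γ_j^{γ_j}
 · φ(h_l + (H_l−h_l)x_l − γ_l, γ_l)/γ_l^{γ_l}`. [cite: Zlobin2005Coefficients, §4 Lemma 6 eq. (4)] -/
def growthF (L : LinParams) (x : ℕ → ℝ) : ℝ :=
  (∏ j ∈ Finset.Icc 1 L.l, ∏ i ∈ Finset.Ioc (L.r (j - 1)) (L.r j),
      ((L.β i : ℝ) - L.α i) ^ ((L.β i : ℝ) - L.α i) /
        phiZ ((L.α i : ℝ) - L.hMin j - ((L.hMax j : ℝ) - L.hMin j) * x j) ((L.β i : ℝ) - L.α i)) *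
    (∏ j ∈ Finset.Icc 1 (L.l - 1),
      phiZ ((L.hMin (j + 1) : ℝ) + ((L.hMax (j + 1) : ℝ) - L.hMin (j + 1)) * x (j + 1) - L.hMin j -
          ((L.hMax j : ℝ) - L.hMin j) * x j) (L.γ j) / (L.γ j : ℝ) ^ (L.γ j : ℝ)) *
    (phiZ ((L.hMin L.l : ℝ) + ((L.hMax L.l : ℝ) - L.hMin L.l) * x L.l - L.γ L.l) (L.γ L.l) /
      (L.γ L.l : ℝ) ^ (L.γ L.l : ℝ))

/-- **Zlobin 2005, Theorem 2** (named fact, statement only; a THEOREM in print — the growth of the coefficients).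
For a linearly growing family satisfying `Hyp` (in particular `c₁ ≤ q₁`, `c_{j−1}+c_j ≤ q_j`) and every `M` bounding
Zlobin's function `F` (4) on `[0,1]^l` (the source takes `M = max F`), the linear forms `S_n(z)` have expansions
`S_n(z) = Σ_{s⃗} P_{s⃗,n}(z⁻¹) Le_{s⃗}(z)` whose polynomials have heights `≤ M^{n+o(n)}`: for every `ε > 0` and
all large `n`, every coefficient is at most `exp(n(log M + ε))` in absolute value (existence form; "the"
polynomials by `expansion_unique`). [cite: Zlobin2005Coefficients, §4 Theorem 2] -/
def theorem2 : Prop :=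
  ∀ L : LinParams, L.Hyp →
    ∀ M : ℝ, (∀ x : ℕ → ℝ, (∀ j ∈ Finset.Icc 1 L.l, 0 ≤ x j ∧ x j ≤ 1) → growthF L x ≤ M) →
      ∀ ε : ℝ, 0 < ε → ∀ᶠ n : ℕ in atTop,
        ∃ coef : List ℕ →₀ ℚ[X], IsLeExpansion (L.paramsAt n).S coef ∧
          ∀ (s : List ℕ) (i : ℕ), |(((coef s).coeff i : ℚ) : ℝ)| ≤ Real.exp (n * (Real.log M + ε))

end Literature.NumberTheory.Irrationality.Zlobin2005
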